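import Summits.HodgeConjecture.HodgeConjecture.Theorems.SoloBlindIsoCensus

/-!
# ASTypes — the Artebani–Sarti bookkeeping of the isotrivial `j = 0` strata (solo-blind s78/s79)

Solo-blind programme, `work/s78/lattice-check.md` (PROP AST) and `work/s79/as-partwise.md`
(REMARK PBP); claims SB-C671, SB-C672.  Companion of the `IsoCensus` file (same directory).

Informal setting (nothing geometric is formalised here).  On a jacobian elliptic K3 surface
`X : y² = x³ + b(t)` with `deg b = 12` and root multiplicities `k₁, …, k_s ∈ {1,…,5}` (fibres
`II, IV, I₀*, IV*, II*`) the non-symplectic automorphism `σ = (x,y,t) ↦ (ζ₃x, y, t)` of order three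
acts trivially on the base.  Artebani–Sarti [AS08, Thm 2.2, Cor 2.7] attach to any non-symplectic
`σ` of order three the invariants `n` (isolated fixed points), `k` (fixed curves), `g` (genus of the
non-rational fixed curve), `m` (`rk S(σ)^⊥ = 2m`) and `a` (`disc S(σ) ≅ (ℤ/3)^a`) and prove
`m + n = 10`, `g = 3 + k - n` and `2g = m - a` (equivalently `a = n + 4 - 2k`).

THE DICTIONARY, per root of multiplicity `k = 1,…,5` (`lattice-check.md` §2–§3, `as-partwise.md` §2):
* `fixC = (0,0,0,1,2)`: fixed curves inside the fibre — none in `II`, `IV` and `I₀*` (for this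
  action `σ` permutes the three non-identity simple components of an `I₀*` fibre), the centre of
  `IV*`, the components `F₁, F₇` of `II*` [AS08 Lemma 4.1, Prop 4.2];
* `isoP = (0,1,1,3,4)`: isolated fixed points inside the fibre — the values for `II, IV, IV*, II*` are
  forced by [AS08 Prop 4.2 with Thm 2.2] (type `(n,2)` = `n` fibres `IV` + `12-2n` fibres `II` with
  fixed curves `O, D` only; type `(n,3)` = one `IV*` + `n-3` `IV`; type `(n,4)` = one `II*` + `n-4` `IV`);
  for `I₀*` the centre carries exactly one fixed point off the fixed curves (`as-partwise.md` §2);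
* `discA = (0,1,1,1,0)`: factors `ℤ/3` of `disc S(σ)` — `a(A₂) = a(E₆) = 1`, `a(E₈) = 0` [AS08 §1],
  and the `σ`-invariant part of an `I₀*` lattice has determinant `3`; minus `2` globally when every
  `kᵢ` is even (`b = c²`: the `3`-torsion sections `(0, ±c)` enlarge the lattice by index `3`);
* `coinv = (0,0,1,0,0)`: extra `ℤ[ζ₃]`-rank of `S(σ)^⊥` beyond `T` (`rk T = 2s - 4` for the very
  general member of a stratum, file `SoloBlindIsoCensus`, imported), so `m = (s - 2) + n₃`;
* global fixed curves: the zero section `O` and `D = {x = 0} = {y² = b(t)}` — two rational curves if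
  all `kᵢ` are even, else one curve of genus `#{i : kᵢ odd}/2 - 1` (all other fixed curves rational).

What this file certifies (closed computations only — `decide`, `omega`, list inductions):
* `partwise` : REMARK PBP — for `k = 1..5`: `1 + coinv + isoP = k`, `2 + 2·coinv + 2·fixC = k + (k mod 2)`,
  `1 + coinv + 2·fixC + discA = k`; i.e. summed over the parts, EACH of AS08's three relations for the
  dictionary values is the identity `Σ kᵢ = 12`;
* `as_relations` : hence for EVERY multiplicity list (parts in `[1,5]`, sum `12` — all `47` strata of
  `IsoCensus` at once, no enumeration) the dictionary values satisfy `m + n = 10`, `n + g = 3 + k`,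
  `n + 4 = a + 2k`, `2g + a = m`;
* `as_constraints` : and the constraints of [AS08 Thm 2.8] (`a ≤ min(m, 22-2m)`,
  `a ∈ {0, 22-2m} → m ≡ 2 (4)`) and the existence conditions of [AS08 Thm 1.5] for
  `(r, a) = (22 - 2m, a)` hold for every such list;
* `table9`, `asTypes9` : the nine-row table of PROP AST (d) for the `s = 6` (`m_T = 4`) strata:
  `(m, n, k, g, a, r)` and the types `(n,k) = (6,3),(6,3),(6,4),(6,4),(5,2),(4,2),(5,3),(3,2),(5,4)`;
* `general_members` : [AS08 Prop 4.2]'s general member of `𝓜_{n,k}` for each type met, and that the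
  dictionary returns `(n,k)` on it (rows 1–4 ↦ `{1²,2³,4}`, `{1³,2²,5}`; rows 5, 7, 9 ↦ the `s = 7`
  strata `{1²,2⁵}`, `{1⁴,2²,4}`, `{1⁵,2,5}` of REMARK S7; rows 6, 8 ↦ `{1⁴,2⁴}`, `{1⁶,2³}`);
* `n6_components` : at `m = 4` (`n = 6`) the constraints leave exactly `k ∈ {3, 4}` — the two
  components `𝓜³_{(6,0,3)}`, `𝓜³_{(6,1,4)}` of the order-three classification used in PROP GP3;
* `fixtable_predicted` : the `24` pairs `(n,k)` allowed by the quoted constraints — a PREDICTION of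
  [AS08, Table 1] (whose LaTeX did not survive text extraction and was not seen), for the referee.

Bookkeeping only: no statement about surfaces, lattices as such, Hodge classes or the summit is made
or implied; the inputs from [AS08] are quoted, not re-proved.
Reference: [AS08] M. Artebani, A. Sarti, Non-symplectic automorphisms of order 3 on K3 surfaces,
Math. Ann. 342 (2008) 903–921, arXiv:0801.3101 (Thm 1.5, Thm 2.2, Cor 2.7, Thm 2.8, Lemma 4.1, Prop 4.2).
-/

set_option linter.dupNamespace false
set_option synthInstance.maxSize 8192
set_option synthInstance.maxHeartbeats 400000

namespace Summit.HodgeConjecture.HodgeConjecture.Theorems.ASTypes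

/-! ## The per-fibre dictionary -/

/-- Fixed curves of `σ` inside the fibre over a root of multiplicity `k` (`IV*`: the centre; `II*`: `F₁, F₇`). -/
def fixC : ℕ → ℕ
  | 4 => 1 | 5 => 2 | _ => 0

/-- Isolated fixed points of `σ` inside the fibre over a root of multiplicity `k`. -/
def isoP : ℕ → ℕ
  | 2 => 1 | 3 => 1 | 4 => 3 | 5 => 4 | _ => 0

/-- Factors `ℤ/3` contributed to `disc S(σ)` by the fibre (`A₂`, invariant part of `D₄`, `E₆`: one; `E₈`: none). -/
def discA : ℕ → ℕ
  | 2 => 1 | 3 => 1 | 4 => 1 | _ => 0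

/-- Extra `ℤ[ζ₃]`-rank of `S(σ)^⊥` contributed by the fibre (`I₀*`: one). -/
def coinv : ℕ → ℕ
  | 3 => 1 | _ => 0

/-- Indicator of a `II*` fibre (used only to expose `fixC = 2·five + [k = 4]` to linear arithmetic). -/
def five : ℕ → ℕ
  | 5 => 1 | _ => 0

/-- REMARK PBP (part-wise form of AS08's relations): for every admissible multiplicity the three
combinations of dictionary values that enter `m + n`, `n + g - k` and `n - a - 2k` equal `k` itself
(the second up to the parity term that feeds the genus of `D`). -/
theorem partwise (k : ℕ) (h1 : 1 ≤ k) (h5 : k ≤ 5) :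
    1 + coinv k + isoP k = k ∧
      2 + 2 * coinv k + 2 * fixC k = k + k % 2 ∧
        1 + coinv k + 2 * fixC k + discA k = k := by
  interval_cases k <;> decide

/-- Auxiliary per-part inequalities (used for the boundary case `a = 0` of [AS08 Thm 2.8]). -/
theorem partwise_aux (k : ℕ) (h1 : 1 ≤ k) (h5 : k ≤ 5) :
    coinv k ≤ discA k ∧ 2 * fixC k ≤ isoP k ∧ isoP k ≤ 2 * fixC k + discA k ∧
      2 * five k ≤ fixC k ∧ fixC k ≤ 2 * five k + discA k := by
  interval_cases k <;> decide

/-! ## Sums over a multiplicity list -/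

/-- `Σ_{k ∈ l} f k`. -/
def S (f : ℕ → ℕ) (l : List ℕ) : ℕ := (l.map f).sum

/-- `Σ` over the empty list. -/
@[simp] theorem S_nil (f : ℕ → ℕ) : S f [] = 0 := rfl

/-- `Σ` over a cons. -/
@[simp] theorem S_cons (f : ℕ → ℕ) (a : ℕ) (t : List ℕ) : S f (a :: t) = f a + S f t := by
  simp [S]

/-- Number of odd parts (`Σ (k mod 2)`); `D → ℙ¹` is branched exactly over the odd-multiplicity roots. -/
def nOdd (l : List ℕ) : ℕ := S (fun k => k % 2) l

/-- The part-wise identities summed over a list with parts in `[1,5]`. -/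
theorem sums (l : List ℕ) (h : ∀ k ∈ l, 1 ≤ k ∧ k ≤ 5) :
    l.length + S coinv l + S isoP l = l.sum ∧
      2 * l.length + 2 * S coinv l + 2 * S fixC l = l.sum + nOdd l ∧
        l.length + S coinv l + 2 * S fixC l + S discA l = l.sum := by
  induction l with
  | nil => simp [nOdd]
  | cons a t ih =>
    have ha := h a (by simp)
    have ht : ∀ k ∈ t, 1 ≤ k ∧ k ≤ 5 := fun k hk => h k (by simp [hk])
    obtain ⟨i1, i2, i3⟩ := ih ht
    obtain ⟨p1, p2, p3⟩ := partwise a ha.1 ha.2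
    simp only [nOdd, List.length_cons, List.sum_cons, S_cons] at *
    omega

/-- The auxiliary inequalities summed. -/
theorem sums_aux (l : List ℕ) (h : ∀ k ∈ l, 1 ≤ k ∧ k ≤ 5) :
    S coinv l ≤ S discA l ∧ 2 * S fixC l ≤ S isoP l ∧ S isoP l ≤ 2 * S fixC l + S discA l ∧
      2 * S five l ≤ S fixC l ∧ S fixC l ≤ 2 * S five l + S discA l := by
  induction l with
  | nil => simp
  | cons a t ih =>
    have ha := h a (by simp)
    have ht : ∀ k ∈ t, 1 ≤ k ∧ k ≤ 5 := fun k hk => h k (by simp [hk])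
    obtain ⟨i1, i2, i3, i4, i5⟩ := ih ht
    obtain ⟨p1, p2, p3, p4, p5⟩ := partwise_aux a ha.1 ha.2
    simp only [S_cons] at *
    omega

/-- The number of odd parts has the parity of the sum. -/
theorem nOdd_parity (l : List ℕ) : nOdd l % 2 = l.sum % 2 := by
  induction l with
  | nil => simp [nOdd]
  | cons a t ih =>
    simp only [nOdd, S_cons, List.sum_cons] at *
    omega

/-! ## The global invariants of a stratum (dictionary values) -/

/-- `m = rk S(σ)^⊥ / 2 = (s - 2) + n₃`. -/
def asM (l : List ℕ) : ℕ := l.length - 2 + S coinv l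

/-- `n` = number of isolated fixed points. -/
def nIso (l : List ℕ) : ℕ := S isoP l

/-- `k` = number of fixed curves: `O`, the components of `D` (two iff all parts are even), and the fibre curves. -/
def kFix (l : List ℕ) : ℕ := 1 + (if nOdd l = 0 then 2 else 1) + S fixC l

/-- `g` = genus of the non-rational fixed curve (`D`, of genus `nOdd/2 - 1`; `0` if there is none). -/
def gFix (l : List ℕ) : ℕ := nOdd l / 2 - 1

/-- `a` with `disc S(σ) ≅ (ℤ/3)^a`: the fibre contributions, lowered by `2` by the `3`-torsion when all parts are even. -/
def aLat (l : List ℕ) : ℕ := S discA l - (if nOdd l = 0 then 2 else 0)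

/-- `r = rk S(σ) = 22 - 2m`. -/
def asR (l : List ℕ) : ℕ := 22 - 2 * asM l

/-- The Artebani–Sarti type `(n, k)` predicted by the dictionary (`n = 10 - m`). -/
def asType (l : List ℕ) : ℕ × ℕ := (10 - asM l, kFix l)

/-- AS08's relations hold for the dictionary values on EVERY `j = 0` isotrivial stratum:
`m + n = 10` [Thm 2.2], `g = 3 + k - n` [Thm 2.2], `a = n + 4 - 2k` [p. 6], `2g = m - a` [Cor 2.7]. -/
theorem as_relations (l : List ℕ) (h : ∀ k ∈ l, 1 ≤ k ∧ k ≤ 5) (hs : l.sum = 12) :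
    asM l + nIso l = 10 ∧ nIso l + gFix l = 3 + kFix l ∧
      nIso l + 4 = aLat l + 2 * kFix l ∧ 2 * gFix l + aLat l = asM l := by
  obtain ⟨e1, e2, e3⟩ := sums l h
  have ep := nOdd_parity l
  have hb := IsoCensus.length_bounds l 5 h
  simp only [asM, nIso, kFix, gFix, aLat]
  split_ifs with h0 <;> omega

/-- The constraints of [AS08 Thm 2.8] and the existence conditions of [AS08 Thm 1.5] (for the pair
`(r, a) = (22 - 2m, a)`; the rank-`2` case `{1¹²}` has `(r,a) = (2,0) = U`) hold for the dictionary
values on every stratum. -/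
theorem as_constraints (l : List ℕ) (h : ∀ k ∈ l, 1 ≤ k ∧ k ≤ 5) (hs : l.sum = 12) :
    aLat l ≤ min (asM l) (22 - 2 * asM l) ∧
      ((aLat l = 0 ∨ aLat l = 22 - 2 * asM l) → asM l % 4 = 2) ∧
      asR l % 2 = 0 ∧ (aLat l % 2 = 0 → asR l % 4 = 2) ∧ (aLat l % 2 = 1 → asR l % 4 = 0) ∧
      (asR l % 8 ≠ 2 → aLat l < asR l ∧ 0 < aLat l) := by
  obtain ⟨e1, e2, e3⟩ := sums l h
  obtain ⟨f1, f2, f3, f4, f5⟩ := sums_aux l h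
  have ep := nOdd_parity l
  have hb := IsoCensus.length_bounds l 5 h
  simp only [asM, aLat, asR]
  split_ifs with h0 <;> omega

/-! ## The nine `s = 6` strata (PROP AST (d)) -/

/-- The nine root-multiplicity partitions at `s = 6`, `j = 0` (as in `IsoCensus.strata6J0`):
`{2⁶}`, `{1²,2³,4}`, `{1⁴,4²}`, `{1³,2²,5}`, `{1,2⁴,3}`, `{1²,2²,3²}`, `{1³,2,3,4}`, `{1³,3³}`, `{1⁴,3,5}`. -/
def strata6J0 : List (List ℕ) :=
  [[2, 2, 2, 2, 2, 2], [4, 2, 2, 2, 1, 1], [4, 4, 1, 1, 1, 1], [5, 2, 2, 1, 1, 1],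
   [3, 2, 2, 2, 2, 1], [3, 3, 2, 2, 1, 1], [4, 3, 2, 1, 1, 1], [3, 3, 3, 1, 1, 1],
   [5, 3, 1, 1, 1, 1]]

/-- The list is literally the one of `IsoCensus` (whose completeness/soundness theorems therefore apply). -/
theorem strata6J0_eq : strata6J0 = IsoCensus.strata6J0 := rfl

/-- PROP AST (d), the nine-row table `(m, n, k, g, a, r)`:
`(4,6,3,0,4,14)`, `(4,6,3,0,4,14)`, `(4,6,4,1,2,14)`, `(4,6,4,1,2,14)`, `(5,5,2,0,5,12)`,
`(6,4,2,1,4,10)`, `(5,5,3,1,3,12)`, `(7,3,2,2,3,8)`, `(5,5,4,2,1,12)`. -/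
theorem table9 :
    strata6J0.map (fun l => (asM l, nIso l, kFix l, gFix l, aLat l, asR l)) =
      [(4, 6, 3, 0, 4, 14), (4, 6, 3, 0, 4, 14), (4, 6, 4, 1, 2, 14), (4, 6, 4, 1, 2, 14),
       (5, 5, 2, 0, 5, 12), (6, 4, 2, 1, 4, 10), (5, 5, 3, 1, 3, 12), (7, 3, 2, 2, 3, 8),
       (5, 5, 4, 2, 1, 12)] := by
  decide

/-- The Artebani–Sarti types of the nine strata: `(6,3),(6,3),(6,4),(6,4),(5,2),(4,2),(5,3),(3,2),(5,4)`. -/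
theorem asTypes9 :
    strata6J0.map asType =
      [(6, 3), (6, 3), (6, 4), (6, 4), (5, 2), (4, 2), (5, 3), (3, 2), (5, 4)] := by
  decide

/-- [AS08 Prop 4.2]: for `k = 2, …, 6` the general member of `𝓜_{n,k}` is `y² = x³ + p₁₂(t)` with
`n` double roots (`k = 2`); one `4`-uple and `n-3` double roots (`k = 3`); one `5`-uple and `n-4` double
roots (`k = 4`); one `5`-uple, one `4`-uple and `n-7` double roots (`k = 5`); two `5`-uple and `n-8`
double roots (`k = 6`); all other roots simple (`deg = 12`).  Junk (`[]`) for other `k`. -/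
def generalMember (n k : ℕ) : List ℕ :=
  if k = 2 then List.replicate n 2 ++ List.replicate (12 - 2 * n) 1
  else if k = 3 then 4 :: (List.replicate (n - 3) 2 ++ List.replicate (14 - 2 * n) 1)
  else if k = 4 then 5 :: (List.replicate (n - 4) 2 ++ List.replicate (15 - 2 * n) 1)
  else if k = 5 then 5 :: 4 :: (List.replicate (n - 7) 2 ++ List.replicate (17 - 2 * n) 1)
  else if k = 6 then 5 :: 5 :: (List.replicate (n - 8) 2 ++ List.replicate (18 - 2 * n) 1)
  else []

/-- The general members of the components met by the nine strata, and idempotence of the dictionary on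
them: rows 1, 2 ↦ `{1²,2³,4}` (row 2 itself), rows 3, 4 ↦ `{1³,2²,5}` (row 4 itself), rows 5, 7, 9 ↦ the
`s = 7` strata `{1²,2⁵}` (`X_S`), `{1⁴,2²,4}`, `{1⁵,2,5}` of REMARK S7, rows 6, 8 ↦ `{1⁴,2⁴}`, `{1⁶,2³}`. -/
theorem general_members :
    strata6J0.map (fun l => generalMember (asType l).1 (asType l).2) =
      [[4, 2, 2, 2, 1, 1], [4, 2, 2, 2, 1, 1], [5, 2, 2, 1, 1, 1], [5, 2, 2, 1, 1, 1],
       [2, 2, 2, 2, 2, 1, 1], [2, 2, 2, 2, 1, 1, 1, 1], [4, 2, 2, 1, 1, 1, 1],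
       [2, 2, 2, 1, 1, 1, 1, 1, 1], [5, 2, 1, 1, 1, 1, 1]] ∧
    ∀ l ∈ strata6J0, asType (generalMember (asType l).1 (asType l).2) = asType l := by
  decide

/-- The constraints of [AS08 Thm 2.8 / Thm 1.5 / Thm 2.2 / Cor 2.7] on a type `(n, k)`:
`m = 10 - n ≥ 1`; for `k = 0`: `n = 3` and `a = m`; for `k ≥ 1`: `g = 3 + k - n ≥ 0`, `a = n + 4 - 2k ≥ 0`;
then `a ≤ min(m, 22 - 2m)`, `a ∈ {0, 22-2m} → m ≡ 2 (4)`, and for `r = 22 - 2m > 2` the conditions of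
Thm 1.5 (`r` even; `r ≡ 2 (4)` if `a` even, `r ≡ 0 (4)` if `a` odd; `r > a > 0` if `r ≢ 2 (8)`).
A `Bool`-valued test (closed arithmetic), so that the tables below are checked by `decide`. -/
def admissible (n k : ℕ) : Bool :=
  let m := 10 - n
  let a := if k = 0 then m else n + 4 - 2 * k
  let r := 22 - 2 * m
  decide (n ≤ 9 ∧ (k = 0 → n = 3) ∧ (1 ≤ k → n ≤ k + 3 ∧ 2 * k ≤ n + 4) ∧
    a ≤ min m (22 - 2 * m) ∧ ((a = 0 ∨ a = 22 - 2 * m) → m % 4 = 2) ∧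
    (2 < r → r % 2 = 0 ∧ (a % 2 = 0 → r % 4 = 2) ∧ (a % 2 = 1 → r % 4 = 0) ∧
      (r % 8 ≠ 2 → a < r ∧ 0 < a)))

/-- PROP AST (c): at `m = 4` (`n = 6`) exactly `k ∈ {3, 4}` is admissible (`(6,2)`: `a = 6 > 4`;
`(6,5)`: `a = 0` with `m = 4 ≢ 2 (4)`; `k ≥ 6`: `a < 0`). -/
theorem n6_components : ∀ k ≤ 12, admissible 6 k = true ↔ (k = 3 ∨ k = 4) := by
  decide

/-- The `24` types `(n,k)` allowed by the quoted constraints (prediction of [AS08, Table 1], not seen). -/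
def fixtablePredicted : List (ℕ × ℕ) :=
  [(0, 1), (0, 2), (1, 1), (1, 2), (2, 1), (2, 2), (3, 0), (3, 1), (3, 2), (3, 3), (4, 1), (4, 2),
   (4, 3), (4, 4), (5, 2), (5, 3), (5, 4), (6, 3), (6, 4), (7, 4), (7, 5), (8, 5), (8, 6), (9, 6)]

/-- Completeness and soundness of the predicted table within `n ≤ 12`, `k ≤ 12`. -/
theorem fixtable_predicted :
    ∀ n ≤ 12, ∀ k ≤ 12, admissible n k = true ↔ (n, k) ∈ fixtablePredicted := by
  decide

/-- The types met by the nine `s = 6` strata are admissible, and every type of the predicted table with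
`k ≥ 2` is met by the general member of [AS08 Prop 4.2] (a multiplicity list of sum `12` on which the
dictionary returns `(n,k)`), while for `k ≤ 1` no `j = 0` isotrivial stratum has that type (`O` and `D`
are always fixed: `kFix ≥ 2`). -/
theorem fixtable_met :
    (∀ l ∈ strata6J0, admissible (asType l).1 (asType l).2 = true) ∧
    (∀ nk ∈ fixtablePredicted, 2 ≤ nk.2 →
      (generalMember nk.1 nk.2).sum = 12 ∧ asType (generalMember nk.1 nk.2) = nk) ∧
    (∀ l : List ℕ, 2 ≤ kFix l) := by
  refine ⟨by decide, by decide, fun l => ?_⟩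
  simp only [kFix]
  split_ifs <;> omega

end Summit.HodgeConjecture.HodgeConjecture.Theorems.ASTypes
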